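import Summits.QuantumFields.YangMills.Theorems.UnitScaleTiltHalvingCombTorusPlaquettesCore
import HarnessLib

/-!
# Line H (`BirthV10.stub_halvingStep`, stmt-QuantumFields-19200) — LEMMA B-al-2, **COROLLARY ★: THE COMB TOP AVERAGE OF THE PRE-GAUGED MEMBER FIELD HAS PLAQUETTES
# WITHIN `ε₁·(1 + frames) + O(ρ)` ON EVERY BOX** — the (R-P) row of the B-al-3 door from the per-level comparison (R-cmp), the fibre and print's frames
# ([Balaban1985Averaging] (89)∕(92)∕(97), (42)∕(43); [Balaban1985Variational] (6), (156))

Cell `ym3-torus` (HUMAN RULING D-0037: YM₃ on T³ is ladder rung R3 — NOT d = 4, NOT infinite volume, NOT a mass gap, NOT the Clay problem), width seat `ym3-torus-px3` gen 5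
((B-v) CONCRETE TOWER + COROLLARY pen, ★★OWNER g29 04:11:16Z).  `--supports stmt-QuantumFields-19200 --as helper`; THEOREMS ONLY (0 `def`, 0 `sorry`); count-neutral; nothing
here claims (B-iv), the (b)-row, (M2′), the stub, the crux or the gap.

WHY.  The θ-row of the (M2′) assembly (✓p694481) needs the plaquettes of the COMB top average `C_k = avgIter L U′ k`, `U′ = pull X̂ 0`, `X̂ = (U^{gJ})♭`, in the currency `ε₁ + O(ε₀²)`
(LOCATE «J2′» (V2): an `ε₀`-linear top datum kills the halving; the socket's `InAk` alone gives only `4ε₀`, ✓`HalvingCombTorusTower.plaqSmall_avgIter_level`).  The `ε₁` lives in the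
FIBRE: `U ∈ 𝔅_k(V)` with `PlaqSmall ε₁ V` makes the torus top average `V̄ = ℰp^{(k)}U` `ε₁`-flat (✓`plaqSmall_iter_of_mem_fibre`), `V̄♭ = Ū^{(k)}(U♭)` (✓`unitsField_toUField_iter_eq_emlIterU`),
and print's (92) with the covariance (11) writes `V̄♭ = (D_k)^{ψ}`, `D_k = dbarIterU k X̂`, `ψ = (gJ ∘ emb^k)⁻¹·ν_k` (✓`emlIterU_eq_gaugeActT_dbarIterU`) — so a plaquette of `D_k` is a
plaquette of `V̄♭` conjugated by `ψ`, i.e. by the ACCUMULATED FRAME `ν_k` at its corner (the `SU(2)` factor is isometric).  The frames are within `t` of `1` by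
✓`Prop8ChartDoubleBarAccFrameSize.one_add_norm_accFrames_sub_one_le_exp` fed with the PER-LEVEL in-block sizes `σ_j = δc·p_j + (102∕100)ρ_j` of `D_j` (px15's ✓`twoBlock_readings` on
a single block: H_j + block-axiality + `p_j`), and B-al-2's comparison `‖D_k(π b)⁻¹C_k(b) − 1‖ ≤ ρ_k` moves the bound to `C_k` through a four-bond conjugation identity.

WHAT IS PROVED (namespace `…Theorems.HalvingCombTorusPlaquettes`):
* (FILE 1∕2 ✓`…HalvingCombTorusPlaquettesCore`: §0 the four-bond conjugation identity, §1 in-block sizes `norm_dbarIterU_inblock_sub_one_le`, §2 `hol_pull_plaq_eq_conj`,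
  `norm_hol_pull_sub_one_le_of_plaqSmall`.)
* §3 ★★★ `plaqSmall_avgIter_of_levels` — MEMBER STATEMENT: from the per-level comparison `hcmp : ∀ j ≤ k, ‖D_j(π_j b)⁻¹C_j(b) − 1‖ ≤ R·(Lʲ)⁴(Lᵏ)⁻⁴` (= ✓`comb_eq_dbar_mul_defect_levels_of_step`'s
  conclusion, `R = 240c₁δc²ε₀²`), `U ∈ regFibrePr … V`, `PlaqSmall ε₁ V`, the guards `InAk` on `univ` ∕ `InAx` and scalar windows: on EVERY box,
  `PlaqSmall (avgIter L U′ (K−n)) lo hi (6·ε₁ + 16·R)` (frames within `t ≤ 1`, `(1+2t)(1+t) ≤ 6`; `(1+2R)²(1+4R)−1 ≤ 9R…`, constants not optimised).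
HONEST SCOPE.  The displayed `hcmp` is B-al-2 (✓p696214∕levels ∘ (B-iv)); the windows are the v10 pack's; constants crude.  NOT a claim about the stub, the crux, the rung or a mass gap.

References: T. Bałaban, CMP **98** (1985) 17–51 [Balaban1985Averaging] ((8)–(11) p.19, (42)–(43) pp.23–24, (89) p.31, (92) p.31, (97)–(100) p.32, (110) p.34); CMP **102**
(1985) 277–309 [Balaban1985Variational] ((6) p.278, (156) p.302); CMP **99** (1985) 75–102 [Balaban1985RegularSpaces] ((1.7) p.77, (1.19) p.79).
-/

set_option autoImplicit false

noncomputable section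

open scoped BigOperators Matrix.Norms.L2Operator
open NormedSpace

namespace Summit.QuantumFields.YangMills.Theorems.HalvingCombTorusPlaquettes

open Literature.MathematicalPhysics.QuantumFieldTheory.Balaban1983to89
open Literature.MathematicalPhysics.QuantumFieldTheory.Balaban1983to89.T3ContinuumYM3Torus
open Literature.MathematicalPhysics.QuantumFieldTheory.Balaban1983to89.T3PrintedRegularMinimiser (regFibrePr)
open Literature.MathematicalPhysics.QuantumFieldTheory.Balaban1983to89.T3UnitLawDensityEML (ℰp)
open T4Continuum BlockAveraging
open B7Prop1Explicit renaming Site → LSite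
open B7Prop1Explicit (e e_apply boxVec axialFn gaugeAct hol plaqWord U1 mem_U1 axialFn_mem norm_units_conj_sub_one_le norm_units_inv_conj_sub_one_le norm_inv_sub_one_le
  hol_gaugeAct_closed disp_plaqWord)
open B7Prop1Local (InBox bondHi PlaqIn hol_plaqWord_eq)
open B9Eq335PlaquettesOfRegularCubeZd (one_add_norm_mul_sub_one_le)
open B7Prop2Explicit (avgIter pdev C0 c2')
open B7Prop2SpecialUnitary (specialUnitaryUnits specialUnitaryUnits_le_U1)
open B8Ineq132 (InAk)
open B8Eq119TwistedAxial (InAx)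
open B8Lemma1NonAbelian (PlaqSmall)
open B10Eq27TorusAxialLog (pull pull_apply transl unitsField toUField gaugeActT gaugeActT_apply holT pull_gaugeActT hol_pull h13_unitsField
  unitsField_mem_unitaryUnits dist1_plaqHol_toUField)
open B8Thm2SetupTorus (toUGauge)
open Node00 (coverAt coverAt_apply coverAt_valLift)
open T3ConstrainedMinimiser (fibre)
open Summit.QuantumFields.YangMills.Theorems.Prop7AxialReprPrint (pull_toUField_mem pdev_pull_lt)
open Summit.QuantumFields.YangMills.Theorems.Prop8Chart (emlIterU)
open Summit.QuantumFields.YangMills.Theorems.Prop8ChartDoubleBar (vframeU dbarAvgU dbarIterU exists_accFrames_dbarIterU)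
open Summit.QuantumFields.YangMills.Theorems.Prop8ChartDoubleBarAccFrameSize (one_add_norm_accFrames_sub_one_le_exp)
open Summit.QuantumFields.YangMills.Theorems.P1FlatCoreDP1Target (plaqSmall_iter_of_mem_fibre unitsField_toUField_iter_eq_emlIterU emlIterU_eq_gaugeActT_dbarIterU)
open Summit.QuantumFields.YangMills.Theorems.HalvingCombStepReadings (twoBlock_readings update_mem_U1 tgt_coverAt)
open Summit.QuantumFields.YangMills.Theorems.HalvingCombStepGeometry (pairGauge_values)
open Summit.QuantumFields.YangMills.Theorems.HalvingCombTorusTower (transl_zero_eq_coverAt plaqSmall_avgIter_level avgIter_mem_U1 hblk_of_inAx p_level_le)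
open Summit.QuantumFields.YangMills.Theorems.Prop7ChartSigmaT3 (unitsField_toUField_gaugeAct)

open Summit.QuantumFields.YangMills.Theorems.HalvingCombTorusPlaquettesCore (norm_conj_near_sub_one_le one_add_norm_plaq_le_of_ratios
  norm_dbarIterU_inblock_sub_one_le hol_pull_plaq_eq_conj norm_hol_pull_sub_one_le_of_plaqSmall)

/-! ## §3 ★★★ The member statement -/

section Member

variable (F : T3Family) {n K : ℕ}

/-- Geometric level sums: `Σ_{i<k} (Lⁱ)ᵃ·(Lᵏ)⁻ᵃ ≤ 1` for `Lᵃ ≥ 2` (`= ((Lᵃ)ᵏ − 1)∕((Lᵃ − 1)(Lᵃ)ᵏ)`). [folklore] -/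
theorem sum_level_ratio_le_one {x : ℝ} (hx : 2 ≤ x) (k : ℕ) : ∑ i ∈ Finset.range k, x ^ i * (x ^ k)⁻¹ ≤ 1 := by
  have hx0 : 0 < x := by linarith
  have hxk : 0 < x ^ k := pow_pos hx0 k
  rw [← Finset.sum_mul, ← div_eq_mul_inv, div_le_one hxk]
  have hgeom : (∑ i ∈ Finset.range k, x ^ i) * (x - 1) = x ^ k - 1 := geom_sum_mul x k
  nlinarith [Finset.sum_nonneg (fun i (_ : i ∈ Finset.range k) => (pow_pos hx0 i).le)]

/-- `(Lⁱ)ᵃ·((Lᵏ)⁻¹)ᵃ = (Lᵃ)ⁱ·((Lᵃ)ᵏ)⁻¹`. [folklore] -/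
theorem level_ratio_pow (L : ℝ) (a i k : ℕ) : (L ^ i) ^ a * ((L ^ k)⁻¹) ^ a = (L ^ a) ^ i * ((L ^ a) ^ k)⁻¹ := by
  rw [inv_pow, ← pow_mul, ← pow_mul, ← pow_mul, ← pow_mul, mul_comm i a, mul_comm k a]

/-- scalar bookkeeping: `(1+2R)(1+4R)(1+2R) ≤ 1 + 11R` for `0 ≤ R ≤ 1∕200`. [folklore] -/
theorem scalar_RR {R : ℝ} (hR0 : 0 ≤ R) (hRw : R ≤ 1 / 200) : (1 + 2 * R) * (1 + 4 * R) * (1 + 2 * R) ≤ 1 + 11 * R := by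
  have hR2 : R * R ≤ R * (1 / 200) := mul_le_mul_of_nonneg_left hRw hR0
  nlinarith [mul_nonneg hR0 hR0, mul_nonneg (mul_nonneg hR0 hR0) hR0]

/-- scalar bookkeeping: `(1+4τ)(1+2τ) ≤ 3` for `0 ≤ τ ≤ 1∕4`. [folklore] -/
theorem scalar_tt {τ : ℝ} (hτ0 : 0 ≤ τ) (hτ4 : τ ≤ 1 / 4) : (1 + 2 * (2 * τ)) * (1 + 2 * τ) ≤ 3 := by
  nlinarith [mul_nonneg hτ0 hτ0]

/-- scalar bookkeeping: the final combination `1 + c ≤ A(1 + dd)`, `A ≤ 1 + 11R`, `dd ≤ 3ε₁`, `ε₁ ≤ 1` ⇒ `c ≤ 3ε₁ + 44R`. [folklore] -/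
theorem scalar_final {c A dd R ε₁ : ℝ} (h4 : 1 + c ≤ A * (1 + dd)) (hA : A ≤ 1 + 11 * R) (hdd0 : 0 ≤ dd)
    (hdd : dd ≤ 3 * ε₁) (hR0 : 0 ≤ R) (hε₁1 : ε₁ ≤ 1) : c ≤ 3 * ε₁ + 44 * R := by
  have h1 : A * (1 + dd) ≤ (1 + 11 * R) * (1 + 3 * ε₁) := mul_le_mul hA (by linarith) (by linarith) (by linarith)
  have hRe : R * ε₁ ≤ R := by nlinarith
  nlinarith [h1, hRe]

/-- ★★★ **COROLLARY ★ OF LEMMA B-al-2 — THE COMB TOP AVERAGE IS `3ε₁ + 44ρ`-FLAT ON EVERY BOX.**  Member `(F, n, K)`, `k = K − n`, `U ∈ regFibrePr … V` with `PlaqSmall ε₁ V`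
(`ε₁ ≤ 1`), pre-gauge `gJ`, `X̂ = (U^{gJ})♭`, `U′ = pull X̂ 0`; guards `InAk` on `univ` and `InAx` (⇒ block-axiality); the PER-LEVEL comparison `hcmp` of B-al-2
(✓`comb_eq_dbar_mul_defect_levels_of_step_inAx`: `R = 240c₁δc²ε₀²`); scalar windows (Prop. 2: `C₀·2ε₀ ≤ 1∕3`, `4ε₀ ≤ c₂′`; `10⁷L³ε₀ ≤ 1` for the guarded∕unguarded identity;
`δc·4ε₀ ≤ 1∕200`, `R ≤ 1∕200`; frames: `600·((d+2)L)·(δc·4ε₀ + (102∕100)R) ≤ 1`).  Then on EVERY box `[lo, hi]` of `ℤ³`: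
`PlaqSmall (avgIter L U′ k) lo hi (3·ε₁ + 44·R)`.
Proof: §1 per level (in-block sizes `σ_i = δc·p_i + (102∕100)R·q_i`, geometric), ✓`one_add_norm_accFrames_sub_one_le_exp` at `S := univ` (frames within `t ≤ ½`), print's (92) with
the covariance (✓`emlIterU_eq_gaugeActT_dbarIterU`, ✓`unitsField_toUField_iter_eq_emlIterU`, ✓`unitsField_toUField_gaugeAct`), §2, and the four-bond identity §0 at `ρ := R`.
[cite: Balaban1985Averaging, (89) p.31, (92) p.31, (97)-(100) p.32, (42)-(43) pp.23-24; Balaban1985Variational, (6) p.278, (156) p.302; Balaban1987RG1, (0.4) p.253] -/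
theorem plaqSmall_avgIter_of_levels (hnK : n < K) {ε₀ ε₁ R : ℝ} (hε₀ : 0 < ε₀) (hε7 : 10 ^ 7 * (F.L : ℝ) ^ 3 * ε₀ ≤ 1)
    (hε₁ : 0 ≤ ε₁) (hε₁1 : ε₁ ≤ 1) (hR0 : 0 ≤ R)
    (V : GaugeField (F.P n) 0 (Matrix.specialUnitaryGroup (Fin 2) ℂ)) (U : GaugeField (F.P K) 0 (Matrix.specialUnitaryGroup (Fin 2) ℂ))
    (hU : U ∈ regFibrePr F n K hnK.le ε₀ V) (hV : PlaqSmall ε₁ V) (gJ : GaugeTransf (F.P K) 0 (Matrix.specialUnitaryGroup (Fin 2) ℂ))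
    (hInAk : InAk (F.P K).L (K - n) (((F.L : ℝ)⁻¹) ^ (K - n)) ε₀ (fun _ => (Set.univ : Set (LSite (F.P K).d)))
      (pull (unitsField (toUField (GaugeField.gaugeAct gJ U))) 0))
    (hInAx : ∀ m, m ≤ K - n → ∀ Λ : ℕ → Set (LSite (F.P K).d),
      InAx (F.P K).L m Λ (1 : LSite (F.P K).d → Fin (F.P K).d → (Matrix (Fin 2) (Fin 2) ℂ)ˣ) (pull (unitsField (toUField (GaugeField.gaugeAct gJ U))) 0))
    (hα3 : C0 (F.P K).d * (2 * ε₀) ≤ 1 / 3) (hα2 : 2 * (2 * ε₀) ≤ c2' (F.P K).d (F.P K).L)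
    (hcmp : ∀ j, j ≤ K - n → ∀ (x : LSite (F.P K).d) (μ : Fin (F.P K).d),
      ‖(((dbarIterU j (unitsField (toUField (GaugeField.gaugeAct gJ U))) ⟨coverAt (F.P K) j x, μ⟩)⁻¹ *
            avgIter (F.P K).L (pull (unitsField (toUField (GaugeField.gaugeAct gJ U))) 0) j x μ : (Matrix (Fin 2) (Fin 2) ℂ)ˣ) :
          Matrix (Fin 2) (Fin 2) ℂ) - 1‖ ≤ R * ((((F.P K).L : ℝ) ^ j) ^ 4 * ((((F.P K).L : ℝ) ^ (K - n))⁻¹) ^ 4))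
    (hδw : (((2 * ((F.P K).d * (F.P K).L) + 1) * ((F.P K).d * ((F.P K).L - 1) + (F.P K).L) : ℕ) : ℝ) * (4 * ε₀) ≤ 1 / 200) (hRw : R ≤ 1 / 200)
    (hσw : 600 * ((((F.P K).d + 2) * (F.P K).L : ℕ) : ℝ) *
      ((((2 * ((F.P K).d * (F.P K).L) + 1) * ((F.P K).d * ((F.P K).L - 1) + (F.P K).L) : ℕ) : ℝ) * (4 * ε₀) + 102 / 100 * R) ≤ 1)
    (lo hi : LSite (F.P K).d) :
    PlaqSmall (avgIter (F.P K).L (pull (unitsField (toUField (GaugeField.gaugeAct gJ U))) 0) (K - n)) lo hi (3 * ε₁ + 44 * R) := by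
  letI : CStarAlgebra (Matrix (Fin 2) (Fin 2) ℂ) := B10Eq29TubeLine.cstarAlgebraMatrix 2
  -- letters
  set X : GaugeField (F.P K) 0 (Matrix (Fin 2) (Fin 2) ℂ)ˣ := unitsField (toUField (GaugeField.gaugeAct gJ U)) with hXdef
  set U' : LSite (F.P K).d → Fin (F.P K).d → (Matrix (Fin 2) (Fin 2) ℂ)ˣ := pull X 0 with hU'
  set k : ℕ := K - n with hk
  set Lr : ℝ := ((F.P K).L : ℝ) with hLr
  set δcN : ℝ := (((2 * ((F.P K).d * (F.P K).L) + 1) * ((F.P K).d * ((F.P K).L - 1) + (F.P K).L) : ℕ) : ℝ) with hδcN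
  set ℓ : ℝ := ((((F.P K).d + 2) * (F.P K).L : ℕ) : ℝ) with hℓ
  have hL2 : 2 ≤ (F.P K).L := (F.P K).hL.2
  have hL1 : (1 : ℝ) ≤ Lr := by rw [hLr]; exact_mod_cast (le_trans (by norm_num) hL2)
  have hL0 : (0 : ℝ) < Lr := by linarith
  have hLr2 : (2 : ℝ) ≤ Lr := by rw [hLr]; exact_mod_cast hL2
  have hd : 0 < (F.P K).d := by rw [T3Family.P_d]; norm_num
  have hkm : k ≤ (F.P K).m + (F.P K).K := by show K - n ≤ F.m + K; omega
  have hδcN0 : 0 ≤ δcN := Nat.cast_nonneg _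
  have hℓ0 : 0 ≤ ℓ := Nat.cast_nonneg _
  -- the fine data (as in the tower)
  have hU'G : ∀ w κ, U' w κ ∈ specialUnitaryUnits (Fin 2) := pull_toUField_mem (GaugeField.gaugeAct gJ U) 0
  have h52 : pdev U' < 2 * ε₀ * ((((F.P K).L : ℝ) ^ k)⁻¹) ^ 2 := pdev_pull_lt hε₀ hInAk 0
  have hblk := hblk_of_inAx U' hInAx
  -- per-level letters
  have hq_le : ∀ i, i ≤ k → (Lr ^ i) ^ 4 * ((Lr ^ k)⁻¹) ^ 4 ≤ 1 := fun i hi => by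
    rw [← mul_pow, ← div_eq_mul_inv]
    exact pow_le_one₀ (by positivity) ((div_le_one (pow_pos hL0 k)).mpr (pow_le_pow_right₀ hL1 hi))
  -- §1 at every level `i < k`: in-block sizes of `D_i`
  set σ : ℕ → ℝ := fun i => δcN * (4 * ε₀ * (Lr ^ i) ^ 2 * ((Lr ^ k)⁻¹) ^ 2) + 102 / 100 * (R * ((Lr ^ i) ^ 4 * ((Lr ^ k)⁻¹) ^ 4)) with hσ
  have hσ0 : ∀ i, i < k → 0 ≤ σ i := fun i _ => by positivity
  have hD : ∀ i, i < k → ∀ y ∈ (Set.univ : Set (Site (F.P K) (i + 1))), ∀ b : PBond (F.P K) i, blockOf b.src = y → blockOf b.tgt = y →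
      ‖((dbarIterU i X b : (Matrix (Fin 2) (Fin 2) ℂ)ˣ) : Matrix (Fin 2) (Fin 2) ℂ) - 1‖ ≤ σ i := by
    intro i hi y _ b hs ht
    have hi2 : i + 2 ≤ (F.P K).m + (F.P K).K := by show i + 2 ≤ F.m + K; have := F.hm; omega
    have hik : i ≤ k := hi.le
    have hp0 : 0 ≤ 4 * ε₀ * (Lr ^ i) ^ 2 * ((Lr ^ k)⁻¹) ^ 2 := by positivity
    have hp4 : 4 * ε₀ * (Lr ^ i) ^ 2 * ((Lr ^ k)⁻¹) ^ 2 ≤ 4 * ε₀ := p_level_le hL1 hε₀.le hik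
    have hCax : ∀ (w : LSite (F.P K).d) (r : Fin (F.P K).d → Fin (F.P K).L),
        axialFn (avgIter (F.P K).L U' i) (((F.P K).L : ℤ) • w) (((F.P K).L : ℤ) • w + boxVec (F.P K).L r) = 1 := by
      intro w r
      have h := hblk (k - 1 - i) (by omega) w r
      have hidx : k - (k - 1 - i + 1) = i := by omega
      rw [hidx] at h; exact h
    refine norm_dbarIterU_inblock_sub_one_le hi2 hd (avgIter (F.P K).L U' i) (fun x μ => avgIter_mem_U1 U' hU'G hε₀ hα3 hα2 h52 hik x μ)
      (dbarIterU i X) hp0 hCax (fun lo' hi' => ?_) (hcmp i (by omega)) ?_ ?_ y b hs ht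
    · have h := plaqSmall_avgIter_level U' hU'G hε₀ hα3 hα2 (k := k) h52 hik lo' hi'
      rw [hLr]; exact h
    · exact (mul_le_mul_of_nonneg_left hp4 hδcN0).trans hδw
    · exact ((mul_le_mul_of_nonneg_left (hq_le i hik) hR0).trans (by rw [mul_one])) |>.trans hRw
  -- the frames: within `t` of `1` at every top site, `t ≤ ½`
  obtain ⟨ν, hν0, hνs, hDν⟩ := exists_accFrames_dbarIterU X
  have hσle : ∀ i, i < k → σ i ≤ δcN * (4 * ε₀) + 102 / 100 * R := by
    intro i hi
    rw [hσ]
    exact add_le_add (mul_le_mul_of_nonneg_left (p_level_le hL1 hε₀.le hi.le) hδcN0)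
      (mul_le_mul_of_nonneg_left ((mul_le_mul_of_nonneg_left (hq_le i hi.le) hR0).trans (by rw [mul_one])) (by norm_num))
  have hσw' : ∀ i, i < k → 600 * ℓ * σ i ≤ 1 := by
    intro i hi
    have h600 : 0 ≤ 600 * ℓ := by positivity
    exact (mul_le_mul_of_nonneg_left (hσle i hi) h600).trans hσw
  have hframe := one_add_norm_accFrames_sub_one_le_exp X ν hν0 hνs hkm (fun i => (Set.univ : Set (Site (F.P K) i))) (fun _ _ _ _ => Set.mem_univ _)
    σ hσ0 hσw' hD
  -- the summed sizes: `Σ_{i<k} σ_i ≤ δc·4ε₀ + (102/100)R`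
  have hsum : ∑ i ∈ Finset.range k, σ i ≤ δcN * (4 * ε₀) + 102 / 100 * R := by
    have hs2 : ∑ i ∈ Finset.range k, (Lr ^ i) ^ 2 * ((Lr ^ k)⁻¹) ^ 2 ≤ 1 := by
      simp_rw [level_ratio_pow Lr 2]
      exact sum_level_ratio_le_one (hLr2.trans (le_self_pow₀ hL1 (by norm_num))) k
    have hs4 : ∑ i ∈ Finset.range k, (Lr ^ i) ^ 4 * ((Lr ^ k)⁻¹) ^ 4 ≤ 1 := by
      simp_rw [level_ratio_pow Lr 4]
      exact sum_level_ratio_le_one (hLr2.trans (le_self_pow₀ hL1 (by norm_num))) k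
    rw [hσ, Finset.sum_add_distrib]
    have e1 : ∑ i ∈ Finset.range k, δcN * (4 * ε₀ * (Lr ^ i) ^ 2 * ((Lr ^ k)⁻¹) ^ 2) = δcN * (4 * ε₀) * ∑ i ∈ Finset.range k, (Lr ^ i) ^ 2 * ((Lr ^ k)⁻¹) ^ 2 := by
      rw [Finset.mul_sum]; refine Finset.sum_congr rfl fun i _ => by ring
    have e2 : ∑ i ∈ Finset.range k, 102 / 100 * (R * ((Lr ^ i) ^ 4 * ((Lr ^ k)⁻¹) ^ 4)) = 102 / 100 * R * ∑ i ∈ Finset.range k, (Lr ^ i) ^ 4 * ((Lr ^ k)⁻¹) ^ 4 := by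
      rw [Finset.mul_sum]; refine Finset.sum_congr rfl fun i _ => by ring
    rw [e1, e2]
    have a1 : δcN * (4 * ε₀) * ∑ i ∈ Finset.range k, (Lr ^ i) ^ 2 * ((Lr ^ k)⁻¹) ^ 2 ≤ δcN * (4 * ε₀) * 1 :=
      mul_le_mul_of_nonneg_left hs2 (by positivity)
    have a2 : 102 / 100 * R * ∑ i ∈ Finset.range k, (Lr ^ i) ^ 4 * ((Lr ^ k)⁻¹) ^ 4 ≤ 102 / 100 * R * 1 :=
      mul_le_mul_of_nonneg_left hs4 (by positivity)
    linarith
  set τ : ℝ := 2 * ℓ * (δcN * (4 * ε₀) + 102 / 100 * R) with hτ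
  have hτ0 : 0 ≤ τ := by positivity
  have hτ4 : τ ≤ 1 / 4 := by rw [hτ]; linarith only [hσw]
  have ht : ∀ y : Site (F.P K) k, ‖((ν k y : (Matrix (Fin 2) (Fin 2) ℂ)ˣ) : Matrix (Fin 2) (Fin 2) ℂ) - 1‖ ≤ 2 * τ := by
    intro y
    have h1 := hframe y (Set.mem_univ _)
    have h2 : Real.exp (2 * ℓ * ∑ i ∈ Finset.range k, σ i) ≤ Real.exp τ :=
      Real.exp_le_exp.mpr (by rw [hτ]; exact mul_le_mul_of_nonneg_left hsum (by positivity))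
    have h3 : Real.exp τ - 1 ≤ 2 * τ := by
      have h := Real.abs_exp_sub_one_le (x := τ) (by rw [abs_of_nonneg hτ0]; linarith)
      rw [abs_of_nonneg hτ0] at h
      exact (le_abs_self _).trans h
    rw [hℓ] at h2; linarith
  have h2τ : 2 * τ ≤ 1 / 2 := by linarith
  -- the coarse field of the fibre and print's (92)
  have hUfib : U ∈ fibre F ℰp n K hnK.le V := hU.1.1
  have hUreg := hU.1.2
  set Vbar := Averaging.iter (fun i => BlockAveraging.blockAvg (P := F.P K) (j := i) ℰp) (K - n) U with hVbar
  have hPbar : PlaqSmall ε₁ Vbar := plaqSmall_iter_of_mem_fibre F n K hnK.le V U hUfib hV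
  have hiter : unitsField (toUField Vbar) = emlIterU k (unitsField (toUField U)) := unitsField_toUField_iter_eq_emlIterU F n K hε₀ hε7 U hUreg k le_rfl
  -- `X̂ = ĝJ • U♭`
  set gh : GaugeTransf (F.P K) 0 (Matrix (Fin 2) (Fin 2) ℂ)ˣ := fun x => Unitary.toUnits (toUGauge (F.P K) 2 gJ x) with hgh
  have hX : X = gaugeActT gh (unitsField (toUField U)) := by
    funext c; rw [hXdef, gaugeActT_apply]; exact unitsField_toUField_gaugeAct gJ U c
  -- the descended pre-gauge tower
  let gs : (i : ℕ) → GaugeTransf (F.P K) i (Matrix (Fin 2) (Fin 2) ℂ)ˣ := fun i =>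
    Nat.rec (motive := fun i => Site (F.P K) i → (Matrix (Fin 2) (Fin 2) ℂ)ˣ) gh (fun _ g y => g (emb y)) i
  have hg0 : gs 0 = gh := rfl
  have hgs : ∀ (i : ℕ) (y : Site (F.P K) (i + 1)), gs (i + 1) y = gs i (emb y) := fun _ _ => rfl
  have hgsU : ∀ (i : ℕ) (y : Site (F.P K) i), gs i y ∈ U1 (Matrix (Fin 2) (Fin 2) ℂ) := by
    intro i
    induction i with
    | zero => intro y; exact specialUnitaryUnits_le_U1 (B8Thm2SetupTorus.toUnits_toUGauge_mem gJ _)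
    | succ i ih => intro y; rw [hgs]; exact ih _
  have hνs' : ∀ (i : ℕ) (y : Site (F.P K) (i + 1)), ν (i + 1) y = ν i (emb y) * vframeU (dbarIterU i (gaugeActT gh (unitsField (toUField U)))) y := by
    intro i y; rw [← hX]; exact hνs i y
  have heml : emlIterU k (unitsField (toUField U)) = gaugeActT (fun y : Site (F.P K) k => (gs k y)⁻¹ * ν k y) (dbarIterU k X) := by
    rw [hX]; exact emlIterU_eq_gaugeActT_dbarIterU _ gh ν hν0 hνs' gs hg0 hgs k
  set ψ : GaugeTransf (F.P K) k (Matrix (Fin 2) (Fin 2) ℂ)ˣ := fun y => (gs k y)⁻¹ * ν k y with hψ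
  have hVbarψ : unitsField (toUField Vbar) = gaugeActT ψ (dbarIterU k X) := by rw [hiter, heml]
  -- the plaquette
  intro x κ μ hκμ _ _
  -- (i) the fibre side: `‖hol (pull V̄♭ 0) x ∂p − 1‖ ≤ ε₁`
  have hP := norm_hol_pull_sub_one_le_of_plaqSmall Vbar hPbar x κ μ hκμ
  -- (ii) `hol (pull D_k 0) x ∂p = ψ′⁻¹ · hol (pull V̄♭ 0) x ∂p · ψ′`
  have hconj := hol_pull_plaq_eq_conj (dbarIterU k X) ψ x κ μ
  rw [← hVbarψ] at hconj
  -- (iii) its size: conjugation by `gs` (isometric) and by the frame `ν` (within `2τ ≤ ½`)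
  set Pu : (Matrix (Fin 2) (Fin 2) ℂ)ˣ := hol (pull (unitsField (toUField Vbar)) 0) x (plaqWord κ μ) with hPu
  have hDplaq : ‖((hol (pull (dbarIterU k X) 0) x (plaqWord κ μ) : (Matrix (Fin 2) (Fin 2) ℂ)ˣ) : Matrix (Fin 2) (Fin 2) ℂ) - 1‖ ≤
      (1 + 2 * (2 * τ)) * (1 + 2 * τ) * ε₁ := by
    have e1 : hol (pull (dbarIterU k X) 0) x (plaqWord κ μ) =
        (ν k (transl 0 x))⁻¹ * ((gs k (transl 0 x)) * Pu * (gs k (transl 0 x))⁻¹) * ν k (transl 0 x) := by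
      rw [hconj, hψ]; group
    rw [e1, Units.val_mul, Units.val_mul]
    refine (norm_conj_near_sub_one_le (ν k (transl 0 x)) (ht _) h2τ _).trans ?_
    refine mul_le_mul_of_nonneg_left ?_ (by positivity)
    rw [Units.val_mul, Units.val_mul]
    exact (norm_units_conj_sub_one_le (hgsU k _) _).trans hP
  -- (iv) the four-bond identity: `C_k = D_k·r` bondwise with `‖r − 1‖ ≤ R`
  have hr : ∀ (w : LSite (F.P K).d) (μ' : Fin (F.P K).d),
      ‖(((pull (dbarIterU k X) 0 w μ')⁻¹ * avgIter (F.P K).L U' k w μ' : (Matrix (Fin 2) (Fin 2) ℂ)ˣ) : Matrix (Fin 2) (Fin 2) ℂ) - 1‖ ≤ R := by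
    intro w μ'
    have h := hcmp k le_rfl w μ'
    rw [pull_apply, transl_zero_eq_coverAt]
    refine h.trans ?_
    have : R * ((((F.P K).L : ℝ) ^ k) ^ 4 * ((((F.P K).L : ℝ) ^ k)⁻¹) ^ 4) = R := by
      rw [← mul_pow, mul_inv_cancel₀ (pow_ne_zero _ hL0.ne'), one_pow, mul_one]
    rw [this]
  have hCU : ∀ w μ', avgIter (F.P K).L U' k w μ' ∈ U1 (Matrix (Fin 2) (Fin 2) ℂ) := fun w μ' => avgIter_mem_U1 U' hU'G hε₀ hα3 hα2 h52 le_rfl w μ'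
  have h4 := one_add_norm_plaq_le_of_ratios (hCU x κ) (hCU (x + e κ) μ) (hCU (x + e μ) κ) (by linarith : R ≤ 1 / 8)
    (hr x κ) (hr (x + e κ) μ) (hr (x + e μ) κ) (hr x μ)
  rw [← hol_plaqWord_eq, ← hol_plaqWord_eq] at h4
  -- (v) arithmetic: `(1+2R)²(1+4R)·(1 + 6·…ε₁) − 1 ≤ 3ε₁ + 44R`
  have hP0 : 0 ≤ ‖((hol (pull (dbarIterU k X) 0) x (plaqWord κ μ) : (Matrix (Fin 2) (Fin 2) ℂ)ˣ) : Matrix (Fin 2) (Fin 2) ℂ) - 1‖ := norm_nonneg _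
  have hε' : (1 + 2 * (2 * τ)) * (1 + 2 * τ) * ε₁ ≤ 3 * ε₁ := mul_le_mul_of_nonneg_right (scalar_tt hτ0 hτ4) hε₁
  exact scalar_final h4 (scalar_RR hR0 hRw) hP0 (hDplaq.trans hε') hR0 hε₁1

end Member

end Summit.QuantumFields.YangMills.Theorems.HalvingCombTorusPlaquettes

end
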